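import Mathlib
import HarnessLib
import Summits.AtomisticToContinuum.FouriersLaw.Theorems.VanishingNoiseTransferNoisyFourierAbelLimitAux1

/-!
# The fixed-`L` Abel limit of the open-chain Green–Kubo functional of the velocity-flip pinned chain

`--supports stmt-AtomisticToContinuum-11977` stub file (crux `NoisyFourier`, route `VanishingNoiseTransfer`,
line `abel-kapitza-even-corrector`, registered stub `stub_abelLimit`; assembly over the Aux file
`…NoisyFourierAbelLimitAux1.lean`).

Setting: `𝐏 = pinnedChain ω₂ lam β γ` (all parameters `> 0`), `μ_T = 𝐏.gibbsMeasure L T`, `L ≥ 2`, the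
flip-noisy equilibrium generator `L_ε = X_H + γ S_B + ε S` (`flipGenerator`), `k_0 = p_0² − T`, the total
current `J = Σ_i j_i`, a classical forward field `g ∈ C² ∩ L²(μ_T)` (`L_ε g = −k_0`) and classical Abel
correctors `u_s ∈ C² ∩ L²(μ_T)` (`L_ε u_s = s u_s − J`, `0 < s ≤ 1`). CLAIM (`stub_abelLimit`):
`∫ J u_s dμ_T → (L−1)²·γ·(T² − γ ∫ g k_0 dμ_T)` as `s → 0⁺`.

Proof. (1) The explicit `s = 0` corrector `u₀ = Σ_{i<L−1} (E_{≤i} − γ g)` solves `L_ε u₀ = −J` pointwise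
(`flipGenerator_corrector`). (2) `d_s = u_s − u₀` solves `L_ε d_s = s d_s + s u₀`, so the energy estimate
(`flipDirichlet_le`) gives `ε Σ_i ‖d_s∘F_i − d_s‖² ≤ s ‖u₀‖²`. (3) The odd-pairing bound
(`abs_integral_sum_bondCurrent_mul_le`) gives `|∫ J d_s| ≤ L √(M s ‖u₀‖²/ε) → 0` and `∫ J E_{≤i} = 0`.
(4) Every bond carries the response (`flip_bondResponse`): `∫ J g = (L−1)(γσ_g − T²)`, so
`∫ J u₀ = γ(L−1)²(T² − γσ_g)`, and `∫ J u_s = ∫ J u₀ + ∫ J d_s → γ(L−1)²(T² − γσ_g)`.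

References: Bernardin–Olla 2011 §3 (Green–Kubo for the velocity-flip chain); Bonetto–Lebowitz–Rey-Bellet 2000
§5.2; folklore.
-/

noncomputable section

open MeasureTheory Filter Topology
open scoped BigOperators ContDiff
open Literature.MathematicalPhysics.KineticTheory.HeatConduction
open Literature.MathematicalPhysics.KineticTheory.HeatConduction.HardTether (leftEnergy)
open Summit.AtomisticToContinuum.FouriersLaw.Theorems.SuperadditiveResistance.DeviceLiouville (kin)
open Summit.AtomisticToContinuum.FouriersLaw.Cruxes.SuperadditiveResistance.InsertionToolbox
  (pinnedChain_memLp_two_of_abs_le)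
open Summit.AtomisticToContinuum.FouriersLaw.Theorems.VanishingNoiseBound
  (contDiff_leftEnergy' leftEnergy_mem_Icc leftEnergy_momentumFlip)
open Summit.AtomisticToContinuum.FouriersLaw.Theorems.NoisyFourier.FlipCeiling (flip_bondResponse)

namespace Summit.AtomisticToContinuum.FouriersLaw.Cruxes.NoisyFourier.AbelKapitzaEvenCorrector

/-! ## The registered stub -/

/-- **Registered stub `stub_abelLimit`** (line `abel-kapitza-even-corrector`, crux stmt-AtomisticToContinuum-11977):
the fixed-`L` Abel limit of the open-chain Green–Kubo functional of the velocity-flip pinned chain. For classical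
`C² ∩ L²(μ_T)` Abel correctors `u_s` (`L_ε u_s = s u_s − J`, `0 < s ≤ 1`) and any classical forward field `g`
(`L_ε g = −(p_0² − T)`): `∫ J u_s dμ_T → (L−1)²·γ·(T² − γ∫ g (p_0² − T) dμ_T)` as `s → 0⁺`. See the module
docstring for the proof. [cite: BernardinOlla2011, §3] [folklore] -/
theorem stub_abelLimit :
    ∀ (ω₂ lam β γ T ε : ℝ), 0 < ω₂ → 0 < lam → 0 < β → 0 < γ → 0 < T → 0 < ε → ∀ (L : ℕ), 2 ≤ L → ∀ g : Literature.MathematicalPhysics.KineticTheory.HeatConduction.PhaseSpace L → ℝ, (ContDiff ℝ 2 g ∧ MeasureTheory.MemLp g 2 ((Literature.MathematicalPhysics.KineticTheory.HeatConduction.pinnedChain ω₂ lam β γ).gibbsMeasure L T) ∧ ∀ x, (Literature.MathematicalPhysics.KineticTheory.HeatConduction.pinnedChain ω₂ lam β γ).flipGenerator L T T ε g x = -(Summit.AtomisticToContinuum.FouriersLaw.Theorems.SuperadditiveResistance.DeviceLiouville.kin L 0 x - T)) → ∀ u : ℝ → Literature.MathematicalPhysics.KineticTheory.HeatConduction.PhaseSpace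 L → ℝ, (∀ s : ℝ, 0 < s → s ≤ 1 → ContDiff ℝ 2 (u s) ∧ MeasureTheory.MemLp (u s) 2 ((Literature.MathematicalPhysics.KineticTheory.HeatConduction.pinnedChain ω₂ lam β γ).gibbsMeasure L T) ∧ ∀ x, (Literature.MathematicalPhysics.KineticTheory.HeatConduction.pinnedChain ω₂ lam β γ).flipGenerator L T T ε (u s) x = s * u s x - ∑ i : Fin L, (Literature.MathematicalPhysics.KineticTheory.HeatConduction.pinnedChain ω₂ lam β γ).bondCurrent L i x) → Filter.Tendsto (fun s : ℝ => MeasureTheory.integral ((Literature.MathematicalPhysics.KineticTheory.HeatConduction.pinnedChain ω₂ lam β γ).gibbsMeasure L T) (fun x => (∑ i : Fin L, (Literature.MathematicalPhysics.KineticTheory.HeatConduction.pinnedChain ω₂ lam β γ).bondCurrent L i x) * u s x)) (nhdsWithin 0 (Set.Ioi 0)) (nhds (((L : ℝ) - 1) ^ 2 * (γ * (T ^ 2 - γ * MeasureTheory.integral ((Literature.MathematicalPhysics.KineticTheory.HeatConduction.pinnedChain ω₂ lam β γ).gibbsMeasure L T) (fun x => g x * (Summit.AtomisticToContinuum.FouriersLaw.Theorems.SuperadditiveResistance.DeviceLiouville.kin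 L 0 x - T)))))) := by
  intro ω₂ lam β γ T ε hω hl hβ hγ hT hε L hL g hg u hu
  obtain ⟨hg2, hgL, hpde⟩ := hg
  obtain ⟨m, rfl⟩ : ∃ m, L = m + 1 := ⟨L - 1, by omega⟩
  set P := pinnedChain ω₂ lam β γ with hP
  set μ := P.gibbsMeasure (m + 1) T with hμ
  obtain ⟨M, hM0, hMb⟩ := abs_integral_sum_bondCurrent_mul_le hω hl hβ γ hT
  -- the players
  set J : PhaseSpace (m + 1) → ℝ := fun x => ∑ i : Fin (m + 1), P.bondCurrent (m + 1) i x with hJ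
  have hJL2 : MemLp J 2 μ := memLp_finsetSum _ fun i _ => memLp_bondCurrent hω hl.le hβ.le γ (m + 1) hT i
  have hE2 : ∀ i : Fin (m + 1), ContDiff ℝ 2 (leftEnergy P (m + 1) i) := fun i =>
    contDiff_leftEnergy' P (pinnedChain_contDiff_U ω₂ lam β γ) (pinnedChain_contDiff_V ω₂ lam β γ) (m + 1) i
  have hU0 : ∀ q, 0 ≤ P.U q := fun q => by
    show 0 ≤ ω₂ * q ^ 2 / 2 + lam * q ^ 4 / 4
    positivity
  have hV0 : ∀ r, 0 ≤ P.V r := fun r => by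
    show 0 ≤ r ^ 2 / 2 + β * r ^ 4 / 4
    positivity
  have hEL2 : ∀ i : Fin (m + 1), MemLp (leftEnergy P (m + 1) i) 2 μ := fun i =>
    pinnedChain_memLp_two_of_abs_le hω hl.le hβ.le γ (m + 1) hT (hE2 i).continuous (C := 1) (k := 1) fun x => by
      obtain ⟨h0, h1⟩ := leftEnergy_mem_Icc P hU0 hV0 (m + 1) i x
      rw [abs_of_nonneg h0, pow_one, one_mul]
      linarith
  set u₀ : PhaseSpace (m + 1) → ℝ :=
    fun y => ∑ i : Fin m, (leftEnergy P (m + 1) (Fin.castSucc i) y - γ * g y) with hu₀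
  have hu₀2 : ContDiff ℝ 2 u₀ := ContDiff.sum fun i _ => (hE2 _).sub (contDiff_const.mul hg2)
  have hu₀L : MemLp u₀ 2 μ :=
    memLp_finsetSum _ fun i _ => (hEL2 (Fin.castSucc i)).sub (hgL.const_mul γ)
  have hpde₀ : ∀ x, P.flipGenerator (m + 1) T T ε u₀ x = -J x := fun x =>
    flipGenerator_corrector (ω₂ := ω₂) (lam := lam) (β := β) (γ := γ) T ε hg2 hpde x
  -- the value `∫ J u₀ = m² γ (T² − γ σ_g)`
  set σg : ℝ := ∫ x, g x * (kin (m + 1) 0 x - T) ∂μ with hσg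
  have hJg : ∫ x, J x * g x ∂μ = m * (γ * σg - T ^ 2) := by
    have hk : ∀ k : Fin (m + 1), ∫ x, P.bondCurrent (m + 1) k x * g x ∂μ =
        ∫ x, g x * P.bondCurrent (m + 1) k x ∂μ := fun k =>
      integral_congr_ae (ae_of_all _ fun x => mul_comm _ _)
    have hterm : ∀ i : Fin m, ∫ x, P.bondCurrent (m + 1) (Fin.castSucc i) x * g x ∂μ = γ * σg - T ^ 2 := by
      intro i
      have hi : (Fin.castSucc i).val + 1 < m + 1 := by
        rw [Fin.val_castSucc]; have := i.isLt; omega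
      rw [hk, flip_bondResponse hω hl hβ hγ hT ε hL hg2 hgL hpde hi]
    have hlast : (fun x => P.bondCurrent (m + 1) (Fin.last m) x * g x) = fun _ => 0 := by
      funext x; rw [bondCurrent_fin_last]; ring
    show ∫ x, (∑ i : Fin (m + 1), P.bondCurrent (m + 1) i x) * g x ∂μ = m * (γ * σg - T ^ 2)
    rw [integral_sum_bondCurrent_mul hω hl.le hβ.le γ (m + 1) hT hgL,
      Fin.sum_univ_castSucc (fun i => ∫ x, P.bondCurrent (m + 1) i x * g x ∂μ), hlast, integral_zero, add_zero,
      Finset.sum_congr rfl fun i _ => hterm i, Finset.sum_const, Finset.card_univ, Fintype.card_fin, nsmul_eq_mul]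
  have hJE : ∀ i : Fin (m + 1), ∫ x, J x * leftEnergy P (m + 1) i x ∂μ = 0 := by
    intro i
    have h := hMb (m + 1) (leftEnergy P (m + 1) i) (hEL2 i)
    have h0 : ∑ k : Fin (m + 1),
        ∫ x, (leftEnergy P (m + 1) i (momentumFlip k x) - leftEnergy P (m + 1) i x) ^ 2 ∂μ = 0 := by
      simp [leftEnergy_momentumFlip]
    rw [h0, mul_zero, Real.sqrt_zero, mul_zero] at h
    exact abs_nonpos_iff.1 h
  have hJu₀ : ∫ x, J x * u₀ x ∂μ = (m : ℝ) ^ 2 * (γ * (T ^ 2 - γ * σg)) := by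
    have e : (fun x => J x * u₀ x) =
        fun x => ∑ i : Fin m, (J x * leftEnergy P (m + 1) (Fin.castSucc i) x - γ * (J x * g x)) := by
      funext x
      simp only [hu₀, Finset.mul_sum]
      exact Finset.sum_congr rfl fun i _ => by ring
    have i1 : ∀ i, Integrable (fun x => J x * leftEnergy P (m + 1) i x) μ := fun i =>
      hJL2.integrable_mul (hEL2 i)
    have i2 : Integrable (fun x => γ * (J x * g x)) μ := (hJL2.integrable_mul hgL).const_mul γ
    have hterm : ∀ i : Fin m, ∫ x, (J x * leftEnergy P (m + 1) (Fin.castSucc i) x - γ * (J x * g x)) ∂μ =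
        -(γ * (m * (γ * σg - T ^ 2))) := by
      intro i
      rw [integral_sub (i1 _) i2, integral_const_mul, hJE, hJg]
      ring
    have i12 : ∀ i : Fin m,
        Integrable (fun x => J x * leftEnergy P (m + 1) (Fin.castSucc i) x - γ * (J x * g x)) μ := fun i =>
      (i1 _).sub i2
    rw [e, integral_finsetSum _ fun i _ => i12 i, Finset.sum_congr rfl fun i _ => hterm i,
      Finset.sum_const, Finset.card_univ, Fintype.card_fin, nsmul_eq_mul]
    ring
  -- the bound `|∫ J u_s − ∫ J u₀| ≤ K √s` on `(0, 1]`
  set I : ℝ := ∫ x, u₀ x ^ 2 ∂μ with hI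
  have hI0 : 0 ≤ I := integral_nonneg fun x => sq_nonneg _
  set K : ℝ := ((m + 1 : ℕ) : ℝ) * Real.sqrt (M * I / ε) with hK
  have hbound : ∀ s : ℝ, 0 < s → s ≤ 1 →
      |(∫ x, J x * u s x ∂μ) - (m : ℝ) ^ 2 * (γ * (T ^ 2 - γ * σg))| ≤ K * Real.sqrt s := by
    intro s hs0 hs1
    obtain ⟨hus2, husL, huspde⟩ := hu s hs0 hs1
    set d : PhaseSpace (m + 1) → ℝ := fun y => u s y - u₀ y with hd
    have hd2 : ContDiff ℝ 2 d := hus2.sub hu₀2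
    have hdL : MemLp d 2 μ := husL.sub hu₀L
    have hdpde : ∀ x, P.flipGenerator (m + 1) T T ε d x = s * d x + s * u₀ x := by
      intro x
      have e := flipGenerator_sub' P T T ε hus2 hu₀2 x
      simp only [hd]
      rw [e, huspde x, hpde₀ x]
      ring
    have hEd := flipDirichlet_le hω hl hβ hγ hT ε (m + 1) hs0.le hd2 hdL hu₀L hdpde
    have hJd := hMb (m + 1) d hdL
    set E : ℝ := ∑ i : Fin (m + 1), ∫ x, (d (momentumFlip i x) - d x) ^ 2 ∂μ with hEdef
    have hEle : E ≤ s * I / ε := by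
      rw [le_div_iff₀ hε]
      nlinarith [hEd]
    have hdiff : (∫ x, J x * u s x ∂μ) - (m : ℝ) ^ 2 * (γ * (T ^ 2 - γ * σg)) = ∫ x, J x * d x ∂μ := by
      have iJu : Integrable (fun x => J x * u s x) μ := hJL2.integrable_mul husL
      have iJu₀ : Integrable (fun x => J x * u₀ x) μ := hJL2.integrable_mul hu₀L
      rw [← hJu₀, ← integral_sub iJu iJu₀]
      refine integral_congr_ae (ae_of_all _ fun x => ?_)
      simp only [hd]
      ring
    rw [hdiff]
    have hMI : 0 ≤ M * I / ε := div_nonneg (mul_nonneg hM0 hI0) hε.le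
    calc |∫ x, J x * d x ∂μ| ≤ ((m + 1 : ℕ) : ℝ) * Real.sqrt (M * E) := hJd
      _ ≤ ((m + 1 : ℕ) : ℝ) * Real.sqrt (M * (s * I / ε)) :=
          mul_le_mul_of_nonneg_left (Real.sqrt_le_sqrt (mul_le_mul_of_nonneg_left hEle hM0)) (by positivity)
      _ = K * Real.sqrt s := by
          rw [show M * (s * I / ε) = (M * I / ε) * s by ring, Real.sqrt_mul hMI s, hK]
          ring
  -- conclude
  have hc : (((m + 1 : ℕ) : ℝ) - 1) ^ 2 * (γ * (T ^ 2 - γ * σg)) = (m : ℝ) ^ 2 * (γ * (T ^ 2 - γ * σg)) := by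
    push_cast; ring
  show Tendsto (fun s : ℝ => ∫ x, J x * u s x ∂μ) (𝓝[>] 0)
    (𝓝 ((((m + 1 : ℕ) : ℝ) - 1) ^ 2 * (γ * (T ^ 2 - γ * σg))))
  rw [hc, ← tendsto_sub_nhds_zero_iff]
  refine squeeze_zero_norm' (a := fun s => K * Real.sqrt s) ?_ ?_
  · filter_upwards [Ioc_mem_nhdsGT (zero_lt_one' ℝ)] with s hs
    rw [Real.norm_eq_abs]
    exact hbound s hs.1 hs.2
  · have h : Tendsto (fun s : ℝ => K * Real.sqrt s) (𝓝[>] 0) (𝓝 (K * Real.sqrt 0)) :=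
      ((Real.continuous_sqrt.tendsto 0).mono_left nhdsWithin_le_nhds).const_mul K
    rw [Real.sqrt_zero, mul_zero] at h
    exact h

end Summit.AtomisticToContinuum.FouriersLaw.Cruxes.NoisyFourier.AbelKapitzaEvenCorrector

end
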